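import Literature.AlgebraicGeometry.ShimuraVarieties.UnitaryShimuraCurveEmbeddingComplex
import Literature.AlgebraicGeometry.ShimuraVarieties.UnitaryShimuraCurveEmbeddingWitnessReduction
import Literature.AlgebraicGeometry.Motives.FiniteCoproductVarieties
import HarnessLib

/-!
# The embedded unitary Shimura curve is Zariski-CLOSED among the complex points of the surface's canonical model
# (road (ii) leaf L3.2 «F-IMG»: `Q.pt ∈ C(K⋆, K) → Q ∈ range emb`), assembled from the pieces

Topic `AlgebraicGeometry/ShimuraVarieties`, namespace `…ShimuraVarieties.UnitaryCanonicalModel`. THEOREMS ONLY (no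
definition, no named fact, no instance, no `sorry`).  Cell `hodgecm-mathlib`, road (ii) «embedded-curve descent» of the
census «GS-3 ⇐ #62» (A-p10 g7), piece 3/3 CUT `CUT-R2-5-FIELDS` leaf **L3.2 F-IMG**; books 0.

DATA (the CUT's common context Σ, level-wise).  A rank-3 canonical-model record system ★ `R : RecordSystem L H τ T hT K₀'`
of the compact unitary Shimura SURFACE, a frame `ᵗ(cB)·(a·H)·B = J⋆ ⊕ J⊥` (`τ a` a positive real; ★ `φGS = R_B ∘ (· ⊕ 1)`), a
small curve level `K⋆` and a surface level `K` with `φGS(K⋆) ≤ K`, and the embedded curve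
`emb P := baseChangeEquiv τ (pts_K⁻¹ (embPoints P))`, `P ∈ Sh_{K⋆}(U(J⋆), 𝔻)(ℂ)` (★ `ShimuraSetGS.embPoints`), whose Zariski
closure of underlying points is `C(K⋆, K) ⊆ |(M_K)_τ|` (the VERBATIM spelling of ★ `RecordSystem.image_closure_embPoints_subset`).
The PIECES of `(M_K)_τ` enter PINNED (A-plan1 (g9) ruling «E-OPACITY» 2026-08-29T05:49:44Z): representatives `g_q`, a colimit
cofan `ι_q : X_q ⟶ (M_K)_τ` of compact ball quotients `B_q : UnitaryBallUniformisationDatum 2 X_q` with `B_q.Hℂ = H^τ` and the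
uniformisation clause `ι_q(unif_q(T·lift x)) = pts_K⁻¹[x, g_q K]` — as HYPOTHESES (the head feeds them from ★
`HComp.RecordSystem.exists_pieces_fieldRange`, Summits-side).

RESULTS.
* §1 (generic, any colimit cofan of `Over B`-schemes) `Morphisms.isClosedEmbedding_left_of_isColimit_cofan` — the legs are
  closed embeddings (open immersions with clopen image, ★ `ClopenPieceOfCoproduct`), so images of closed subsets of the
  summands are closed in the apex; `Motives.AlgPoints.exists_eq_map_of_pt_eq_of_isColimit_cofan` — a field-valued point of the apex
  whose underlying point is `ι_i y` is `ι_i P` for a point `P` of the summand over `y` (★ `AlgPoints.range_map_of_isOpenImmersion_holds`).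
* §2 **`RecordSystem.mem_range_emb_of_pt_mem_closure_of_pieces`** — L3.2 ASSEMBLED from a per-piece closedness clause `hZ`:
  «for every piece `q` and every rational `γ ∈ U(H)(L⁺)`, the image `unif_q((γB)^τ(𝔻))` of the translated sub-disc is the set of
  complex points of a Zariski-closed subset of `X_q`» (the content of ★ `PicardCM.specialCyclesAlgebraic_holds` — Kudla–Millson:
  special cycles are algebraic — read on an `L`-coded piece; supplied by the companion leaf over the SubfieldCode currency).
  Proof: finitely many double-coset representatives `s ∈ S` of `U(J⋆)(L⁺)\U(J⋆)(𝔸_f)/K⋆` (★ `exists_finset_doubleCoset_reps`,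
  Godement compactness for the anisotropic `J⋆`); every embedded point is `emb [x, s] = ι_{q_s}(unif_{q_s}((γ_s B)^τ(x ⊕ 0)))`
  (★ `map_piece_unif_frameEmbNeg_eq_embPoints`, bookkeeper `γ_s` of ★ `exists_rational_smul_rep_mem`); so `pt(range emb)` lies in the
  finite union `Y = ⋃_s ι_{q_s}(Z_s)` of images of the closed sets of `hZ`, which is closed (§1) — hence contains `C(K⋆, K)` — and a
  complex point `Q` with `Q.pt ∈ Y` lifts to a complex point of the piece lying on `Z_s` (§1), i.e. to `unif_{q_s}((γ_s B)^τ(x ⊕ 0))`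
  for some `x ∈ 𝔻`, so `Q = emb [x, s]`.  [Milne2005ShimuraVarieties] Thm. 5.16 p. 59 / Lemma 5.13 (the embedded Shimura set,
  finiteness of `G(ℚ)\G(𝔸_f)/K`), [BergeronMillsonMoeglin2016Balls] Part 2 §§3.1–3.3 (special cycles `Γ_W∖𝔹(W^⊥) → Γ∖𝔹`),
  [KudlaMillson1990] Lemma 1.1 (algebraicity).

What is NOT here: the discharge of `hZ` from special cycles over an `L`-coded piece (companion leaf), injectivity of `emb`
(R2-1-inj), the points homeomorphism of the descended curve (L3.4), GS-3 itself.

## References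
* [Milne2005ShimuraVarieties] J. S. Milne, *Introduction to Shimura varieties* (2005/2017): Lemma 5.12–5.13 p. 57, Thm. 5.16 p. 59,
  §13 pp. 117–119.
* [BergeronMillsonMoeglin2016Balls] N. Bergeron, J. Millson, C. Moeglin, Acta Math. 216 (2016), Introduction §1.7, Part 2 §§3.1–3.3.
* [KudlaMillson1990] S. Kudla, J. Millson, Publ. Math. IHÉS 71 (1990), Lemma 1.1, p. 128 and p. 133.
* [GortzWedhorn2020] U. Görtz, T. Wedhorn, *Algebraic Geometry I* (2nd ed. 2020), §(3.5) Example 3.11 (disjoint unions).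
* [SGA1] A. Grothendieck, SGA 1, Exp. XII Prop. 3.1.
-/

set_option autoImplicit false

noncomputable section

open Function MulAction Topology NumberField IsDedekindDomain CategoryTheory CategoryTheory.Limits Matrix AlgebraicGeometry Set
open scoped Matrix ComplexOrder
open Literature.AlgebraicGeometry.Motives
open Literature.NumberTheory.Automorphic Literature.NumberTheory.Automorphic.UnitaryGroup
open Literature.NumberTheory.Automorphic.Liu2021.AppendixC (C5.OpenCompactSubgroup C5.SmallLevel)
open Literature.Geometry.ComplexHyperbolic Literature.Geometry.ComplexHyperbolic.BallModel
open Literature.NumberTheory.Automorphic.ShimuraDissection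

/-! ### §1 Generic plumbing: closed subsets and field-valued points of the apex of a colimit cofan -/

namespace Literature.AlgebraicGeometry.Morphisms

universe v u

/-- **The legs of a colimit cofan of `B`-schemes are CLOSED EMBEDDINGS** (open immersions — ★ `isOpenImmersion_of_isColimit_cofan`
— with clopen image — ★ `isClopen_range_of_isColimit_cofan`), so they carry closed subsets of the summands to closed subsets of the
apex. [cite: GortzWedhorn2020, §(3.5) Proposition 3.10 and Example 3.11 (p. 73)] -/
theorem isClosedEmbedding_left_of_isColimit_cofan {B : Scheme.{u}} {σ : Type v} [Small.{u} σ] {X : σ → Over B} {S : Over B}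
    {f : ∀ i, X i ⟶ S} (hc : IsColimit (Cofan.mk S f)) (i : σ) : IsClosedEmbedding ⇑(f i).left.base := by
  obtain ⟨hc'⟩ := isColimit_cofan_left hc
  haveI : ∀ i, IsOpenImmersion (f i).left := isOpenImmersion_of_isColimit_cofan hc'
  exact ⟨(f i).left.isOpenEmbedding.toIsEmbedding, (isClopen_range_of_isColimit_cofan hc' i).1⟩

end Literature.AlgebraicGeometry.Morphisms

namespace Literature.AlgebraicGeometry.Motives

universe v u

/-- **Field-valued points of the apex over the image of a leg come from that leg**: for a colimit cofan
`(ι_i : X_i ⟶ S)` in `SchemeOver k` and an `L`-point `Q` of `S` with `Q.pt = ι_i y`, there is an `L`-point `P` of `X_i` with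
`P.pt = y` and `ι_i ∘ P = Q` (★ `AlgPoints.range_map_of_isOpenImmersion_holds` for the open immersion `ι_i`, and injectivity of
`ι_i` on points). [cite: SGA1, Exp. XII Prop. 3.1 (xi)] [cite: GortzWedhorn2020, §(3.5) Example 3.11 (p. 73)] -/
theorem AlgPoints.exists_eq_map_of_pt_eq_of_isColimit_cofan {k : Type u} [Field k] {σ : Type} {X : σ → SchemeOver k}
    {S : SchemeOver k} {f : ∀ i, X i ⟶ S} (hc : IsColimit (Cofan.mk S f)) (L : Type u) [Field L] [Algebra k L]
    (Q : AlgPoints S L) (i : σ) (y : ↥(X i).left) (hy : (f i).left.base y = Q.pt) :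
    ∃ P : AlgPoints (X i) L, P.pt = y ∧ AlgPoints.map (f i) P = Q := by
  obtain ⟨hc'⟩ := Morphisms.isColimit_cofan_left hc
  haveI : ∀ i, IsOpenImmersion (f i).left := Morphisms.isOpenImmersion_of_isColimit_cofan hc'
  have hQ : Q ∈ Set.range (AlgPoints.map (f i) : AlgPoints (X i) L → AlgPoints S L) := by
    rw [AlgPoints.range_map_of_isOpenImmersion_holds (f i)]
    exact ⟨y, hy⟩
  obtain ⟨P, hP⟩ := hQ
  refine ⟨P, (f i).left.isOpenEmbedding.injective ?_, hP⟩
  rw [hy, ← hP]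
  rfl

end Literature.AlgebraicGeometry.Motives

/-! ### §2 L3.2 assembled from the per-piece closedness of the translated sub-discs -/

namespace Literature.AlgebraicGeometry.ShimuraVarieties.UnitaryCanonicalModel

variable {L : Type} [Field L] [NumberField L] [IsCMField L] {Jstar : Matrix (Fin 2) (Fin 2) L} {τ : L →+* ℂ}
  {K₀ : C5.OpenCompactSubgroup ↥(finAdelic (↥(maximalRealSubfield L)) L (IsCMField.complexConj L) 2 Jstar)}
  {H : Matrix (Fin 3) (Fin 3) L} {T : GL (Fin 3) ℂ} {hT : formCongr (starRingEnd ℂ) T (H.map τ) = BallModel.J}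
  {K₀' : C5.OpenCompactSubgroup ↥(finAdelic (↥(maximalRealSubfield L)) L (IsCMField.complexConj L) 3 H)}
  (R : RecordSystem L H τ T hT K₀')
  (Jperp : Matrix (Fin 1) (Fin 1) L) (B : GL (Fin 3) L) {a : L} (ha : a ≠ 0)
  (hB : formCongr ((IsCMField.complexConj L : L ≃ₐ[↥(maximalRealSubfield L)] L) : L →+* L) B (a • H) = finSum 2 1 Jstar Jperp)
  (hτa : 0 < (τ a).re) (hτa' : (τ a).im = 0)

set_option maxHeartbeats 400000 in -- instance-heavy adelic / Shimura-set statement: `whnf`/`isDefEq` time out at the default (as ★ F-R23 / ★ `UnitaryShimuraCurveDescendedTower`)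
/-- **L3.2 F-IMG from the pieces: the embedded unitary Shimura curve is Zariski-closed among complex points.**  For an
anisotropic `H`, a small curve level `K⋆`, a surface level `K` with `φGS(K⋆) ≤ K`, PINNED pieces `(g, X, ι, B_q)` of `(M_K)_τ`
(representatives, colimit cofan of compact ball quotients with `B_q.Hℂ = H^τ` and the uniformisation clause), and the per-piece
closedness clause `hZ` («the image `unif_q((γB)^τ(𝔻))` of every translated sub-disc is the complex-point set of a Zariski-closed
subset of `X_q`»): every complex point `Q` of `(M_K)_τ` whose underlying point lies in the Zariski closure `C(K⋆, K)` of the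
embedded curve IS an embedded point, `Q = baseChangeEquiv τ (pts_K⁻¹ (embPoints P))`.  (The converse inclusion is `subset_closure`.)
[cite: Milne2005ShimuraVarieties, Thm. 5.16 p. 59, Lemma 5.12–5.13 p. 57] [cite: BergeronMillsonMoeglin2016Balls, Part 2 §§3.1–3.3]
[cite: KudlaMillson1990, Lemma 1.1, p. 128 and p. 133] -/
theorem RecordSystem.mem_range_emb_of_pt_mem_closure_of_pieces
    (hanis : ∀ v : Fin 3 → L, hermForm (cmConjRingHom L) H v v = 0 → v = 0)
    (Kstar : C5.SmallLevel K₀) (K : C5.SmallLevel K₀') (hK : Kstar.1.1.map (φGS L Jstar Jperp H B ha hB) ≤ K.1.1)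
    (g : orbitRel.Quotient ↥(rational (↥(maximalRealSubfield L)) L (IsCMField.complexConj L) 3 H)
        (CosetSpace (rationalToFinAdelic (↥(maximalRealSubfield L)) L (IsCMField.complexConj L) 3 H) K.1.1) →
      ↥(finAdelic (↥(maximalRealSubfield L)) L (IsCMField.complexConj L) 3 H))
    (hg : ∀ q, Quotient.mk'' (CosetSpace.pt (rationalToFinAdelic (↥(maximalRealSubfield L)) L (IsCMField.complexConj L) 3 H)
      K.1.1 (g q)) = q)
    (X : orbitRel.Quotient ↥(rational (↥(maximalRealSubfield L)) L (IsCMField.complexConj L) 3 H)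
        (CosetSpace (rationalToFinAdelic (↥(maximalRealSubfield L)) L (IsCMField.complexConj L) 3 H) K.1.1) → SchemeOver ℂ)
    (ι : letI : Algebra L ℂ := τ.toAlgebra; ∀ q, X q ⟶ (Motives.baseChangeHom τ).obj (R.M.obj K))
    (hcol : letI : Algebra L ℂ := τ.toAlgebra; IsColimit (Cofan.mk ((Motives.baseChangeHom τ).obj (R.M.obj K)) ι))
    (Bq : ∀ q, UnitaryBallUniformisationDatum 2 (X q)) (hBq : ∀ q, (Bq q).Hℂ = H.map τ)
    (hunif : letI : Algebra L ℂ := τ.toAlgebra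
      ∀ q (x : Ball), AlgPoints.map (L := ℂ) (ι q) ((Bq q).unif ((T : Matrix (Fin 3) (Fin 3) ℂ) *ᵥ BallModel.lift x)) =
        AlgPoints.baseChangeEquiv τ (R.M.obj K) ((R.pts K).symm (ShimuraSet.mk L H τ T hT K.1.1 x (g q))))
    (hZ : ∀ q (γ : ↥(rational (↥(maximalRealSubfield L)) L (IsCMField.complexConj L) 3 H)),
      ∃ Z : Set ↥(X q).left, IsClosed Z ∧ ∀ P : ComplexPoints (X q),
        P.pt ∈ Z ↔ ∃ x ∈ negCone (Jstar.map τ), P = (Bq q).unif (frameEmbNeg τ ((γ : GL (Fin 3) L) * B) x))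
    (Q : letI : Algebra L ℂ := τ.toAlgebra; ComplexPoints ((Motives.baseChangeHom τ).obj (R.M.obj K)))
    (hQ : letI : Algebra L ℂ := τ.toAlgebra
      Q.pt ∈ closure (AlgPoints.pt '' Set.range fun P : ShimuraSetGS L Jstar τ Kstar.1.1 =>
        AlgPoints.baseChangeEquiv τ (R.M.obj K) ((R.pts K).symm
          (ShimuraSetGS.embPoints L H τ T hT Jstar Jperp B ha hB hτa hτa' Kstar.1.1 K.1.1 hK P)))) :
    letI : Algebra L ℂ := τ.toAlgebra
    Q ∈ Set.range fun P : ShimuraSetGS L Jstar τ Kstar.1.1 =>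
      AlgPoints.baseChangeEquiv τ (R.M.obj K) ((R.pts K).symm
        (ShimuraSetGS.embPoints L H τ T hT Jstar Jperp B ha hB hτa hτa' Kstar.1.1 K.1.1 hK P)) := by
  letI : Algebra L ℂ := τ.toAlgebra
  classical
  -- (1) finitely many double-coset representatives of `U(J⋆)(L⁺) \ U(J⋆)(𝔸_f) / K⋆`
  obtain ⟨Sfin, hS⟩ := exists_finset_doubleCoset_reps L H Jstar Jperp B ha hB hanis Kstar.1.1 Kstar.1.2.1
  -- (2) for each representative `s`: its target class `q s` and a bookkeeper `γ s` with `g_{q_s}⁻¹ γ_f φGS(s) ∈ K`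
  let qs : ↥(finAdelic (↥(maximalRealSubfield L)) L (IsCMField.complexConj L) 2 Jstar) →
      orbitRel.Quotient ↥(rational (↥(maximalRealSubfield L)) L (IsCMField.complexConj L) 3 H)
        (CosetSpace (rationalToFinAdelic (↥(maximalRealSubfield L)) L (IsCMField.complexConj L) 3 H) K.1.1) :=
    fun s => Quotient.mk'' (CosetSpace.pt (rationalToFinAdelic (↥(maximalRealSubfield L)) L (IsCMField.complexConj L) 3 H) K.1.1
      (φGS L Jstar Jperp H B ha hB s))
  have hrep : ∀ s, ∃ γ : ↥(rational (↥(maximalRealSubfield L)) L (IsCMField.complexConj L) 3 H),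
      (g (qs s))⁻¹ * (rationalToFinAdelic (↥(maximalRealSubfield L)) L (IsCMField.complexConj L) 3 H γ *
        φGS L Jstar Jperp H B ha hB s) ∈ K.1.1 := by
    intro s
    obtain ⟨γ, hγ⟩ := exists_rational_smul_rep_mem (F := ↥(maximalRealSubfield L)) (c := IsCMField.complexConj L) hg
      (φGS L Jstar Jperp H B ha hB s)
    refine ⟨γ, ?_⟩
    have h := K.1.1.inv_mem hγ
    rwa [_root_.mul_inv_rev, inv_inv] at h
  choose γ hγ using hrep
  -- (3) the closed sets of the pieces
  choose Z hZc hZpt using hZ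
  -- the embedded point `[x, s]` read in the piece `q s` (★ `map_piece_unif_frameEmbNeg_eq_embPoints`)
  have hpiece : ∀ (s) (x : Fin 2 → ℂ) (hx : x ∈ negCone (Jstar.map τ)),
      AlgPoints.map (L := ℂ) (ι (qs s)) ((Bq (qs s)).unif (frameEmbNeg τ ((γ s : GL (Fin 3) L) * B) x)) =
        AlgPoints.baseChangeEquiv τ (R.M.obj K) ((R.pts K).symm
          (ShimuraSetGS.embPoints L H τ T hT Jstar Jperp B ha hB hτa hτa' Kstar.1.1 K.1.1 hK
            (ShimuraSetGS.mk L Jstar τ Kstar.1.1 x hx s))) := fun s x hx =>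
    map_piece_unif_frameEmbNeg_eq_embPoints R Jperp B ha hB hτa hτa' hK (Bq (qs s)) (g (qs s)) s (γ s) (hBq (qs s))
      (ι (qs s)) (hunif (qs s)) (hγ s) x hx
  -- (4) the finite union `Y` of the images of the closed sets `Z (q s) (γ s)`, `s ∈ S`: closed (closed-embedding legs)
  have hce : ∀ q, IsClosedEmbedding ⇑(ι q).left.base := fun q => Morphisms.isClosedEmbedding_left_of_isColimit_cofan hcol q
  let Y : Set ↥((Motives.baseChangeHom τ).obj (R.M.obj K)).left :=
    ⋃ s : ↥Sfin, ⇑(ι (qs s)).left.base '' Z (qs s) (γ s)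
  have hYc : IsClosed Y :=
    isClosed_iUnion_of_finite fun s : ↥Sfin => (hce (qs s)).isClosedMap _ (hZc (qs s) (γ s))
  -- (5) every embedded point lies on `Y`: `[x, uK⋆] = [δ⁻¹x, sK⋆]` for a representative `s`, then read in the piece `q s`
  have hsub : (AlgPoints.pt '' Set.range fun P : ShimuraSetGS L Jstar τ Kstar.1.1 =>
      AlgPoints.baseChangeEquiv τ (R.M.obj K) ((R.pts K).symm
        (ShimuraSetGS.embPoints L H τ T hT Jstar Jperp B ha hB hτa hτa' Kstar.1.1 K.1.1 hK P))) ⊆ Y := by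
    rintro _ ⟨_, ⟨P, rfl⟩, rfl⟩
    obtain ⟨x, hx, u, rfl⟩ := ShimuraSetGS.mk_surjective L Jstar τ Kstar.1.1 P
    obtain ⟨δ, s, hs, k, hk, hu⟩ := hS u
    -- `(φ(δ⁻¹) u)⁻¹ s = k⁻¹ ∈ K⋆`
    have hδ' : ((rationalToFinAdelic (↥(maximalRealSubfield L)) L (IsCMField.complexConj L) 2 Jstar δ⁻¹ :
        ↥(finAdelic (↥(maximalRealSubfield L)) L (IsCMField.complexConj L) 2 Jstar)) * u)⁻¹ * s ∈ Kstar.1.1 := by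
      have heq : ((rationalToFinAdelic (↥(maximalRealSubfield L)) L (IsCMField.complexConj L) 2 Jstar δ⁻¹ :
          ↥(finAdelic (↥(maximalRealSubfield L)) L (IsCMField.complexConj L) 2 Jstar)) * u)⁻¹ * s = k⁻¹ := by
        rw [hu, map_inv]
        group
      rw [heq]
      exact Kstar.1.1.inv_mem hk
    have hx' : ((ratToGLℂ L Jstar τ δ⁻¹ : GL (Fin 2) ℂ) : Matrix (Fin 2) (Fin 2) ℂ) *ᵥ x ∈ negCone (Jstar.map τ) := by
      simpa only [one_smul] using smul_ratToGLℂ_mulVec_mem_negCone L Jstar τ δ⁻¹ one_ne_zero hx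
    have hmove := ShimuraSetGS.mk_eq_mk_mulVec_rep (Kc := Kstar.1.1) x hx u s δ⁻¹ hδ' hx'
    refine Set.mem_iUnion.2 ⟨⟨s, hs⟩, ((Bq (qs s)).unif (frameEmbNeg τ ((γ s : GL (Fin 3) L) * B) _)).pt,
      (hZpt (qs s) (γ s) _).2 ⟨_, hx', rfl⟩, ?_⟩
    dsimp only
    rw [hmove, ← hpiece s _ hx']
    rfl
  -- (6) hence the closure `C(K⋆, K)` lies on `Y`, and `Q.pt` with it
  have hQY : Q.pt ∈ Y := closure_minimal hsub hYc hQ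
  obtain ⟨⟨s, hs⟩, z, hzZ, hzQ⟩ := Set.mem_iUnion.1 hQY
  -- (7) lift `Q` to a complex point of the piece `q s` over `z`, read it on the closed set `Z`
  obtain ⟨P', hP'pt, hP'Q⟩ := AlgPoints.exists_eq_map_of_pt_eq_of_isColimit_cofan hcol ℂ Q (qs s) z hzQ
  have hP'Z : P'.pt ∈ Z (qs s) (γ s) := by rw [hP'pt]; exact hzZ
  obtain ⟨x, hx, hP'⟩ := (hZpt (qs s) (γ s) P').1 hP'Z
  refine ⟨ShimuraSetGS.mk L Jstar τ Kstar.1.1 x hx s, ?_⟩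
  dsimp only
  rw [← hpiece s x hx, ← hP', hP'Q]

end Literature.AlgebraicGeometry.ShimuraVarieties.UnitaryCanonicalModel

end
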